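import Literature.NumberTheory.GaloisRepresentations.IdeleClassBarSIhomLayers
import Literature.NumberTheory.GaloisRepresentations.IdeleClassModUnitsSCoprimeKilling
import Literature.NumberTheory.GaloisRepresentations.IdeleClassModUnitsSInvariantTower
import Literature.NumberTheory.GaloisRepresentations.IdeleClassBarLatticeVanishing
import Literature.Algebra.Homology.TateNakayamaInflationVanishingTorsion
import Literature.GroupTheory.ProfiniteSubquotients
import HarnessLib

/-!
# Every class of `Extʳ_{C_{G_S}}(N, C̄_S)`, `r ≥ 3`, `N` a lattice, is killed by an integer prime to `p` (`S ⊇ S_p`):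
# Milne ADT I Lemma 1.9 / Harari Lemma 16.20 with lattice coefficients for the `P`-class formation `(G_S, C_S)`

Topic `NumberTheory/GaloisRepresentations`; namespace `Literature.NumberTheory.GaloisRepresentations.IdeleClassBar`.  Theorems only; no
definition, no named fact, no instance, no `sorry`.  Sequel of `IdeleClassBarSIhomLayers` (the layers
`Hⁿ(G_S ⧸ V̄_E, (Hom(N, C̄_S))^{V̄_E}) ≅ Hⁿ(Gal(E/K), Hom(N_E, C_S(E)))` and their transitions `ihomInfS`), of
`IdeleClassModUnitsSCoprimeKilling` (§2: cyclotomic layers `M ⊇ E` inside `K_S` with `p^a ∣ [M:E]`), of bsd-line-x1-p1-w5's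
`IdeleClassModUnitsSInvariant(Tower)` (the class modules `(Gal(E/K), C_S(E), ū_E)` and `Inf ū_E = [M:E] ū_M`), of
bsd-line-x1-p1-w4's `TateNakayamaInflationVanishingTorsion` (`IsClassModule.map_ihom_eq_zero_of_nsmul_eq_zero`: Tate–Nakayama with
`Hom`-coefficients for torsion classes) and of door-c6's `IdeleClassBarLatticeVanishing` (§1: `discTopRep`, so that door-c4's
`extIhomAddEquivOfProjective : Extʳ(N, C) ≃+ Extʳ(ℤ, Hom(N, C))` applies to every object).  Cell `bsd-eis`, background lane
«PT-Ш-S-TC», brick D2-TN: this file is FIELD (10) `hN` of `DiscreteRep.tateDualityHypothesesAt_of_coprime` for `C = classBarSD K S`.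
HONEST FRAMING: Galois cohomology of the `S`-idèle classes; no duality theorem and no case of BSD is proved here.

THE STATEMENT IN PRINT.  Milne, ADT I Lemma 1.9 (for a `P`-class formation, with Harari's Lemma 16.20 / Remark 16.24 (b)): for a
finitely generated torsion-free `G`-module `N`, `Extʳ_G(N, C) = lim→ Hʳ(G/U, Hom(N, C^U))`, and for `r ≥ 3` each layer class of
`ℓ`-power order (`ℓ ∈ P`) dies in a deeper layer by the theorem of Tate–Nakayama; for `(G_S, C_S)` and `p` with `S ⊇ S_p`,
`p ∈ P` (Harari Remark 17.1).  Hence every class of `Extʳ_{C_{G_S}}(N, C̄_S)`, `r ≥ 3`, is killed by an integer prime to `p`.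

## What is formalised (`K` a number field, `S : Finset`, `G_S = GaloisGroupUnramifiedOutside K ↑S`, `p` prime, `S ⊇ S_p`)

* §1 **`exists_coprime_layer_ihomInfS_nsmul_eq_zero`**: for a layer `E ⊆ K_S` acting trivially on the lattice and `d` the prime-to-`p`
  part of `[E:K]`, the classes `d · y`, `y ∈ Hⁿ⁺³(Gal(E/K), Hom(N_E, C_S(E)))`, die under `ihomInfS` in a cyclotomic layer `M ⊇ E`.
* §2 `exists_trivialOnS` (a layer inside `K_S` acting trivially), **`exists_coprime_nsmul_eq_zero_ext_triv_ihomObj_classBarSD`**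
  (`Extʳ(ℤ, Hom(N, C̄_S))`, `r ≥ 3`).
* §3 **`exists_coprime_nsmul_eq_zero_ext_latticeDS_classBarSD`** (`Extʳ(N, C̄_S)`, Harari 16.16 (b)),
  `exists_coprime_nsmul_eq_zero_ext_mk_classBarSD` (any `Module ℤ` structure), and **`hN_classBarSD`** — field (10) verbatim:
  `∀ N : DiscreteRepCat ℤ G_S, Module.Finite ℤ N → IsAddTorsionFree N → ∀ r ≥ 3, ∀ x : Ext N (classBarSD K S) r, ∃ d, p.Coprime d ∧ d • x = 0`.

## References
* J. S. Milne, *Arithmetic Duality Theorems* (2nd ed. 2006), I §1, Lemma 1.9 and Theorem 1.8 (proof). [MilneADT2006]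
* D. Harari, *Galois Cohomology and Class Field Theory* (2020), §16.2 Prop. 16.16 (b); §16.3 Lemma 16.20, Remark 16.24 (b); §17.1
  Remark 17.1, Thm. 17.2. [Harari2020]
* J. Neukirch, A. Schmidt, K. Wingberg, *Cohomology of Number Fields*, 2nd ed. (2008), VIII §3 (8.3.8)–(8.3.11). [NeukirchSchmidtWingberg2008]
-/

noncomputable section

open NumberField IsDedekindDomain CategoryTheory CategoryTheory.Limits CategoryTheory.Abelian groupCohomology
open Field (absoluteGaloisGroup)
open Literature.Algebra.Homology Literature.NumberTheory.Automorphic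
open Literature.NumberTheory.GaloisRepresentations.LocalWeilDatum (galFixing)

namespace Literature.NumberTheory.GaloisRepresentations

namespace IdeleClassBar

variable {K : Type} [Field K] [NumberField K] (S : Finset (HeightOneSpectrum (𝓞 K))) (p : ℕ) [hp : Fact p.Prime]
  {V : Type} [AddCommGroup V]
  (ρN : Representation ℤ (GaloisGroupUnramifiedOutside K (↑S : Set (HeightOneSpectrum (𝓞 K)))) V)
  (hρN : DiscreteRep.IsDiscrete (Rep.of ρN)) [Module.Free ℤ V] [Module.Finite ℤ V]

/-! ## §1. The prime-to-`p` part of `Hⁿ⁺³(Gal(E/K), Hom(N_E, C_S(E)))` dies in a cyclotomic layer -/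

omit hρN in
/-- **Tate–Nakayama with `Hom`-coefficients at `p`, per layer** (`S ⊇ S_p`, `E ⊆ K_S` acting trivially on the lattice): there are an
integer `d` prime to `p` (the prime-to-`p` part of `#Gal(E/K)`) and a cyclotomic layer `M ⊇ E` inside `K_S` (`p^{v_p #Gal(E/K)} ∣ [M:E]`)
such that `Inf (d · y) = 0` in `Hⁿ⁺³(Gal(M/K), Hom(N_M, C_S(M)))` for every `y ∈ Hⁿ⁺³(Gal(E/K), Hom(N_E, C_S(E)))` — the class
module `(Gal(E/K), C_S(E), ū_E)` (w5's `isClassModule_classModUnitsCocycle`), `Inf ū_E = [M:E] ū_M`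
(`classModUnitsInf_fundamentalClassModUnits`) and `IsClassModule.map_ihom_eq_zero_of_nsmul_eq_zero`.
[cite: MilneADT2006, I Lemma 1.9][cite: Harari2020, §16.3 Lemma 16.20, Remark 17.1] -/
theorem exists_coprime_layer_ihomInfS_nsmul_eq_zero
    (hSp : ∀ v : HeightOneSpectrum (𝓞 K), ((p : ℕ) : 𝓞 K) ∈ v.asIdeal → v ∈ (↑S : Set (HeightOneSpectrum (𝓞 K))))
    {E : GalLayer K} (hE : ramificationSubgroup K (↑S : Set (HeightOneSpectrum (𝓞 K))) ≤ galFixing K E.1)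
    (hTE : TrivialOnS S ρN E) (n : ℕ) :
    ∃ d : ℕ, p.Coprime d ∧ ∃ (M : GalLayer K) (h : E ≤ M)
      (hM : ramificationSubgroup K (↑S : Set (HeightOneSpectrum (𝓞 K))) ≤ galFixing K M.1),
      ∀ y : groupCohomology (haveI := E.numberField;
          (Rep.ihom (coeffS S ρN hE hTE)).obj (IdeleCohomology.classModUnitsRep K E.1 S)) (n + 3),
        ihomInfS S ρN h hE hM hTE (hTE.mono S h) (n + 3) (d • y) = 0 := by
  haveI := E.finiteDimensional
  haveI := E.isGalois
  haveI := E.numberField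
  letI : Fintype (E.1 ≃ₐ[K] E.1) := Fintype.ofFinite _
  -- `d := #Gal(E/K) / p^{v_p}`
  refine ⟨Nat.card (E.1 ≃ₐ[K] E.1) / p ^ (Nat.card (E.1 ≃ₐ[K] E.1)).factorization p,
    Nat.coprime_ordCompl hp.out (Nat.card_pos (α := E.1 ≃ₐ[K] E.1)).ne', ?_⟩
  -- the cyclotomic layer with `p^{v_p} ∣ [M:E]`
  have hx := GalLayer.exists_le_pow_dvd_finrank p (↑S : Set (HeightOneSpectrum (𝓞 K))) hSp E hE
    ((Nat.card (E.1 ≃ₐ[K] E.1)).factorization p)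
  obtain ⟨M, hM⟩ := hx
  obtain ⟨h, hM'⟩ := hM
  obtain ⟨hSM, hdvd⟩ := hM'
  refine ⟨M, h, hSM, fun y => ?_⟩
  haveI := M.finiteDimensional
  haveI := M.isGalois
  haveI := M.numberField
  letI := GalLayer.algebraOfLE h
  haveI := GalLayer.isScalarTower_of_le h
  -- `S` contains the places ramified in `E`: the class module `(Gal(E/K), C_S(E), ū_E)`
  have hS : ∀ v : HeightOneSpectrum (𝓞 K), v ∉ S → Algebra.IsUnramifiedIn (𝓞 E.1) v.asIdeal := fun v hv =>
    isUnramifiedIn_of_ramificationSubgroup_le_galFixing (K := K) E.1 hE (by rwa [Finset.mem_coe])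
  have hC := IdeleCohomology.isClassModule_classModUnitsCocycle (F := K) (E := E.1) S hS
  -- `Inf ū_E = [M:E] • ū_M` along `(res, classModUnitsInflHom)`
  have hι : groupCohomology.map (GalLayer.resHom h) (IdeleCohomology.classModUnitsInflHom K E.1 M.1 S) 2
      (H2π (IdeleCohomology.classModUnitsRep K E.1 S) (IdeleCohomology.classModUnitsCocycle K E.1 S)) =
      Module.finrank E.1 M.1 • H2π (IdeleCohomology.classModUnitsRep K M.1 S) (IdeleCohomology.classModUnitsCocycle K M.1 S) := by
    rw [IdeleCohomology.H2π_classModUnitsCocycle, IdeleCohomology.H2π_classModUnitsCocycle]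
    exact IdeleCohomology.classModUnitsInf_fundamentalClassModUnits (F := K) (E := E.1) (M := M.1) S
  -- `#Gal(E/K) • y = 0`, so `d • y` is `p^{v_p}`-torsion
  have hy0 : Nat.card (E.1 ≃ₐ[K] E.1) • y = 0 :=
    card_smul_groupCohomology_eq_zero ((Rep.ihom (coeffS S ρN hE hTE)).obj (IdeleCohomology.classModUnitsRep K E.1 S)) (n + 2) y
  have hy1 : p ^ (Nat.card (E.1 ≃ₐ[K] E.1)).factorization p •
      ((Nat.card (E.1 ≃ₐ[K] E.1) / p ^ (Nat.card (E.1 ≃ₐ[K] E.1)).factorization p) • y) = 0 := by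
    rw [← mul_nsmul', Nat.ordProj_mul_ordCompl_eq_self, hy0]
  exact hC.map_ihom_eq_zero_of_nsmul_eq_zero (GalLayer.resHom h) (IdeleCohomology.classModUnitsInflHom K E.1 M.1 S)
    (coeffS S ρN hE hTE) (IdeleCohomology.classModUnitsCocycle K M.1 S) hι hdvd (coeffS S ρN hSM (hTE.mono S h))
    (LinearEquiv.refl ℤ V) (coeffS_refl_comm S ρN h hE hSM hTE (hTE.mono S h)) n _ hy1

/-! ## §2. `Extʳ(ℤ, Hom(N, C̄_S))`, `r ≥ 3`: every class is killed by an integer prime to `p` -/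

omit [Module.Free ℤ V] in
include hρN in
/-- A lattice with open stabilisers is fixed pointwise by `V̄_E` for some layer `E ⊆ K_S` (door-c4's
`exists_openNormalSubgroup_forall_apply_eq` for `G_S` + w3's cofinality `exists_layerSubgroupS_le`). [cite: MilneADT2006, I Theorem 1.8 (proof)] -/
theorem exists_trivialOnS :
    ∃ E₀ : GalLayer K, ramificationSubgroup K (↑S : Set (HeightOneSpectrum (𝓞 K))) ≤ galFixing K E₀.1 ∧ TrivialOnS S ρN E₀ := by
  haveI : TotallyDisconnectedSpace (GaloisGroupUnramifiedOutside K (↑S : Set (HeightOneSpectrum (𝓞 K)))) :=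
    Literature.GroupTheory.ProfiniteSubquotients.totallyDisconnectedSpace_quotient
      (ramificationSubgroup K (↑S : Set (HeightOneSpectrum (𝓞 K)))) (ramificationSubgroup_isClosed K _)
  have hU := DiscreteRep.exists_openNormalSubgroup_forall_apply_eq (latticeDS S ρN hρN)
  obtain ⟨U, hU'⟩ := hU
  have hE := exists_layerSubgroupS_le S U
  obtain ⟨E₀, hE₀⟩ := hE
  exact ⟨E₀, hE₀.1, fun g hg x => hU' g (hE₀.2 hg) x⟩

/-- **`Extʳ_{C_{G_S}}(ℤ, Hom(N, C̄_S))`, `r ≥ 3`: every class is killed by an integer prime to `p`** — w7's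
`exists_coprime_nsmul_eq_zero_of_layers` for the module `Hom(N, C̄_S)`: a class of a layer `U` is pushed to a layer `V̄_E ≤ U` with
`V̄_E` acting trivially on `N`, read in `Hⁿ⁺³(Gal(E/K), Hom(N_E, C_S(E)))` (`ihomLayerCohomologyIsoS`), where its prime-to-`p` multiple
dies in the cyclotomic layer (§1); the square `ihomLayerCohomologyIsoS_stepG` brings this back to `stepG`.
[cite: MilneADT2006, I Lemma 1.9][cite: Harari2020, §16.3 Lemma 16.20, Remark 17.1] -/
theorem exists_coprime_nsmul_eq_zero_ext_triv_ihomObj_classBarSD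
    (hSp : ∀ v : HeightOneSpectrum (𝓞 K), ((p : ℕ) : 𝓞 K) ∈ v.asIdeal → v ∈ (↑S : Set (HeightOneSpectrum (𝓞 K))))
    (r : ℕ) (hr : 3 ≤ r)
    (x : Ext (DiscreteRep.triv (Γ := GaloisGroupUnramifiedOutside K (↑S : Set (HeightOneSpectrum (𝓞 K)))) ℤ)
      (DiscreteRep.ihomObj (latticeDS S ρN hρN) (classBarSD K S)) r) :
    ∃ d : ℕ, p.Coprime d ∧ d • x = 0 := by
  haveI : TotallyDisconnectedSpace (GaloisGroupUnramifiedOutside K (↑S : Set (HeightOneSpectrum (𝓞 K)))) :=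
    Literature.GroupTheory.ProfiniteSubquotients.totallyDisconnectedSpace_quotient
      (ramificationSubgroup K (↑S : Set (HeightOneSpectrum (𝓞 K)))) (ramificationSubgroup_isClosed K _)
  have hr' := Nat.exists_eq_add_of_le' hr
  obtain ⟨n, rfl⟩ := hr'
  have h₀ := exists_trivialOnS S ρN hρN
  obtain ⟨E₀, hE₀⟩ := h₀
  refine DiscreteRep.exists_coprime_nsmul_eq_zero_of_layers (n + 3)
    (DiscreteRep.ihomObj (latticeDS S ρN hρN) (classBarSD K S)) (fun U c => ?_) x
  -- a layer `E ⊆ K_S` with `V̄_E ≤ U`, acting trivially on `N`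
  have h₁ := exists_layerSubgroupS_le S U
  obtain ⟨E₁, hE₁⟩ := h₁
  have h₂ := exists_ge_ge_insideKS S hE₀.1 hE₁.1
  obtain ⟨E, hE'⟩ := h₂
  have hE : ramificationSubgroup K (↑S : Set (HeightOneSpectrum (𝓞 K))) ≤ galFixing K E.1 := hE'.2.2
  have hTE : TrivialOnS S ρN E := hE₀.2.mono S hE'.1
  have hEU : (layerSubgroupS S E : Subgroup (GaloisGroupUnramifiedOutside K (↑S : Set (HeightOneSpectrum (𝓞 K))))) ≤ U :=
    (layerSubgroupS_anti S hE'.2.1).trans hE₁.2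
  -- the prime-to-`p` part `d` of `#Gal(E/K)` and the cyclotomic layer `M`
  have hk := exists_coprime_layer_ihomInfS_nsmul_eq_zero S p ρN hSp hE hTE n
  obtain ⟨d, hd, hk'⟩ := hk
  obtain ⟨M, hk''⟩ := hk'
  obtain ⟨h, hk'''⟩ := hk''
  obtain ⟨hM, hkill⟩ := hk'''
  refine ⟨layerSubgroupS S M, (layerSubgroupS_anti S h).trans hEU, d, hd, ?_⟩
  -- `stepG U V̄_M (d • c) = stepG V̄_E V̄_M (d • stepG U V̄_E c)`
  rw [← DiscreteRep.LayerColimit.stepG_stepG U (layerSubgroupS S E) hEU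
    (DiscreteRep.ihomObj (latticeDS S ρN hρN) (classBarSD K S)) (n + 3) (layerSubgroupS S M) (layerSubgroupS_anti S h) (d • c),
    map_nsmul]
  -- under `isoS_M` it is `ihomInfS (d • isoS_E c₁) = 0`
  have h0 : (ihomLayerCohomologyIsoS S ρN hρN hM (hTE.mono S h) (n + 3)).hom
      (DiscreteRep.LayerColimit.stepG (layerSubgroupS S E) (layerSubgroupS S M) (layerSubgroupS_anti S h)
        (DiscreteRep.ihomObj (latticeDS S ρN hρN) (classBarSD K S)) (n + 3)
        (d • DiscreteRep.LayerColimit.stepG U (layerSubgroupS S E) hEU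
          (DiscreteRep.ihomObj (latticeDS S ρN hρN) (classBarSD K S)) (n + 3) c)) = 0 := by
    rw [ihomLayerCohomologyIsoS_stepG S ρN hρN h hE hM hTE (hTE.mono S h) (n + 3), map_nsmul]
    exact hkill _
  have h1 := congrArg (ihomLayerCohomologyIsoS S ρN hρN hM (hTE.mono S h) (n + 3)).inv h0
  rwa [← ModuleCat.comp_apply, Iso.hom_inv_id, ModuleCat.id_apply, map_zero] at h1

/-! ## §3. `Extʳ(N, C̄_S)`, `r ≥ 3`, and field (10) `hN` -/

/-- **`Extʳ_{C_{G_S}}(N, C̄_S)`, `r ≥ 3`, for the discrete lattice `N = (V, ρN)` (`V` finitely generated free): every class is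
killed by an integer prime to `p`** — `Extʳ(N, C̄_S) ≃+ Extʳ(ℤ, Hom(N, C̄_S))` (Harari 16.16 (b), door-c4's `extIhomAddEquivOfProjective`
on door-c6's discrete presentation `discTopRep`) and §2. [cite: MilneADT2006, I Lemma 1.9][cite: Harari2020, §16.2 Proposition 16.16 (b)] -/
theorem exists_coprime_nsmul_eq_zero_ext_latticeDS_classBarSD
    (hSp : ∀ v : HeightOneSpectrum (𝓞 K), ((p : ℕ) : 𝓞 K) ∈ v.asIdeal → v ∈ (↑S : Set (HeightOneSpectrum (𝓞 K))))
    (r : ℕ) (hr : 3 ≤ r) (x : Ext (latticeDS S ρN hρN) (classBarSD K S) r) :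
    ∃ d : ℕ, p.Coprime d ∧ d • x = 0 := by
  haveI : DiscreteTopology (discTopRep (classBarSD K S)).V := discreteTopology_discTopRep _
  have h := exists_coprime_nsmul_eq_zero_ext_triv_ihomObj_classBarSD S p ρN hρN hSp r hr
    (DiscreteRep.extIhomAddEquivOfProjective (latticeDS S ρN hρN) (discTopRep (classBarSD K S))
      (isDiscrete_discTopRep (classBarSD K S)) r x)
  obtain ⟨d, hd, h0⟩ := h
  refine ⟨d, hd, (map_eq_zero_iff _ (DiscreteRep.extIhomAddEquivOfProjective (latticeDS S ρN hρN)
    (discTopRep (classBarSD K S)) (isDiscrete_discTopRep (classBarSD K S)) r).injective).1 ?_⟩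
  exact (map_nsmul (DiscreteRep.extIhomAddEquivOfProjective (latticeDS S ρN hρN)
    (discTopRep (classBarSD K S)) (isDiscrete_discTopRep (classBarSD K S)) r) d x).trans h0

omit ρN hρN
variable {S}

/-- The lattice case for an arbitrary `Module ℤ` structure on the underlying group (all such structures coincide; a finitely generated
torsion-free abelian group is free). [cite: MilneADT2006, I Lemma 1.9] -/
theorem exists_coprime_nsmul_eq_zero_ext_mk_classBarSD
    (hSp : ∀ v : HeightOneSpectrum (𝓞 K), ((p : ℕ) : 𝓞 K) ∈ v.asIdeal → v ∈ (↑S : Set (HeightOneSpectrum (𝓞 K))))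
    {W : Type} [AddCommGroup W] [inst : Module ℤ W]
    (ρ : Representation ℤ (GaloisGroupUnramifiedOutside K (↑S : Set (HeightOneSpectrum (𝓞 K)))) W)
    (hρ : DiscreteRep.IsDiscrete (Rep.of ρ)) (hfin : Module.Finite ℤ W) (htf : IsAddTorsionFree W) (r : ℕ) (hr : 3 ≤ r)
    (x : Ext (DiscreteRep.mk (Rep.of ρ) hρ) (classBarSD K S) r) : ∃ d : ℕ, p.Coprime d ∧ d • x = 0 := by
  obtain rfl : inst = AddCommGroup.toIntModule W := Subsingleton.elim _ _
  haveI : Module.Free ℤ W := Module.free_of_finite_type_torsion_free'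
  exact exists_coprime_nsmul_eq_zero_ext_latticeDS_classBarSD S p ρ hρ hSp r hr x

/-- **Field (10) `hN` of `DiscreteRep.tateDualityHypothesesAt_of_coprime` for `C = C̄_S`, verbatim** (`S ⊇ S_p`): for every discrete
`G_S`-module `N` whose underlying group is finitely generated (for the module structure it carries) and torsion-free, every `r ≥ 3` and
every `x ∈ Extʳ_{C_{G_S}}(N, C̄_S)`, some integer `d` prime to `p` has `d · x = 0` (Milne ADT I Lemma 1.9 for the `P`-class formation
`(G_S, C_S)` at `p ∈ P`). [cite: MilneADT2006, I Lemma 1.9][cite: Harari2020, §16.3 Lemma 16.20, Remark 16.24 (b), Remark 17.1] -/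
theorem hN_classBarSD
    (hSp : ∀ v : HeightOneSpectrum (𝓞 K), ((p : ℕ) : 𝓞 K) ∈ v.asIdeal → v ∈ (↑S : Set (HeightOneSpectrum (𝓞 K))))
    (N : DiscreteRepCat ℤ (GaloisGroupUnramifiedOutside K (↑S : Set (HeightOneSpectrum (𝓞 K)))))
    (hfin : @Module.Finite ℤ N.obj.V _ _ N.obj.hV2) (htf : IsAddTorsionFree N.obj.V) (r : ℕ) (hr : 3 ≤ r)
    (x : Ext N (classBarSD K S) r) : ∃ d : ℕ, p.Coprime d ∧ d • x = 0 :=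
  exists_coprime_nsmul_eq_zero_ext_mk_classBarSD p hSp (inst := N.obj.hV2) N.obj.ρ N.property hfin htf r hr x

end IdeleClassBar

end Literature.NumberTheory.GaloisRepresentations

end
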